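import Literature.AlgebraicTopology.DiscreteMorseTheory.DiscreteMorseFunction
import Literature.AlgebraicTopology.DiscreteMorseTheory.AlgebraicMorseInequalities
import HarnessLib

/-!
# The weak Morse inequality `b_p ≤ m_p(f)` for a degree of a cell poset realised by a based complex

Bridge between the cell-poset vocabulary of `DiscreteMorseFunction.lean`
(`IsDiscreteMorseFunction f`, `IsCritical f σ`, `morseNumber dim f p` on a preorder of cells with
the covering relation `⋖` as "codimension-one face"; Forman 1998, Def. 2.1 / 2.2) and the PROVED
algebraic weak Morse inequality of `AlgebraicMorseInequalities.lean` (three consecutive terms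
`C₂ →d₂→ C₁ →d₁→ C₀` of a based complex over a division ring, Forman's conditions read with
"facet = nonzero incidence"; Kozlov 2008, §11.3, Thm. 11.24).  If degree `p` of the cell poset is
*realised* by the based triple (`IsDegreeSlice`: the `p`-cells are listed by the basis index type
`K₁`, the cells covering them and covered by them by `K₂`, `K₀`, and the covering relation
between these is exactly nonzero incidence — for the cellular chain complex of a finite regular
CW complex this is Forman's (1.1), `[τ : σ] = ±1` for `σ⁽ᵖ⁾ < τ⁽ᵖ⁺¹⁾`, §1 p. 98, together with
`[τ : σ] = 0` when `σ` is not a face of `τ`; for Kozlov's ranked poset `P(C_*, Ω)` of a based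
complex it holds by definition), then for every real-valued discrete Morse function `f` on the
poset **`dim_F (ker d₁ / im d₂) ≤ m_p(f) = morseNumber dim f p`**
(`IsDegreeSlice.finrank_homology_le_morseNumber`) and
`#(p-cells) ≤ m_p(f) + rank d₁ + rank d₂` (`IsDegreeSlice.card_le_morseNumber_add`).
Everything here is proved; no named facts.

## References

* R. Forman, *Morse theory for cell complexes*, Adv. Math. 134 (1998), §1 (1.1), Def. 2.1–2.2,
  Cor. 8.3. [Forman1998]
* D. Kozlov, *Combinatorial algebraic topology*, Springer (2008), §11.3, Def. 11.22, Thm. 11.24.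
  [Kozlov2008]
-/

noncomputable section

open Function Set Module

namespace Literature.AlgebraicTopology.DiscreteMorseTheory

universe u v w

variable {F : Type u} [DivisionRing F]

section Bridge

variable {C₀ : Type v} {C₁ : Type v} {C₂ : Type v} [AddCommGroup C₀] [Module F C₀]
  [AddCommGroup C₁] [Module F C₁] [AddCommGroup C₂] [Module F C₂]
variable {K₀ K₁ K₂ : Type w}
variable {K : Type*} [Preorder K]

/-- **A based triple realising degree `p` of a cell poset.**  The `p`-cells of the cell poset
`(K, ≤)` (dimension function `dim`) are listed injectively and exhaustively by `ι₁ : K₁ → K`, every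
cell covering (resp. covered by) a `p`-cell is listed by `ι₂` (resp. `ι₀`), and the covering
relation `⋖` of the poset between these cells is exactly "nonzero incidence" in the based triple
`(b₁, d₁, d₂, e₂, φ₀)`.  For the cellular chain complex of a finite regular CW complex over a field
this is Forman's (1.1), `[τ : σ] = ±1` whenever `σ⁽ᵖ⁾ < τ⁽ᵖ⁺¹⁾` (Forman 1998, §1, p. 98), together
with `[τ : σ] = 0` when `σ` is not a face of `τ`; for Kozlov's ranked poset `P(C_*, Ω)` of a based
complex it holds by definition (Kozlov 2008, §11.3). [cite: Kozlov2008, §11.3 (before Def. 11.22)] -/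
structure IsDegreeSlice (dim : K → ℕ) (b₁ : Basis K₁ F C₁) (d₁ : C₁ →ₗ[F] C₀) (d₂ : C₂ →ₗ[F] C₁)
    (e₂ : K₂ → C₂) (φ₀ : K₀ → C₀ →ₗ[F] F) (ι₀ : K₀ → K) (ι₁ : K₁ → K) (ι₂ : K₂ → K) (p : ℕ) :
    Prop where
  /-- the listed `p`-cells have dimension `p` -/
  dim_eq : ∀ σ, dim (ι₁ σ) = p
  /-- the `p`-cells are listed without repetition -/
  injective : Function.Injective ι₁
  /-- every `p`-cell is listed -/
  exists_eq : ∀ x, dim x = p → ∃ σ, ι₁ σ = x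
  /-- every cell covering a listed `p`-cell is a listed `(p+1)`-cell -/
  exists_eq_of_covBy_right : ∀ σ x, ι₁ σ ⋖ x → ∃ τ, ι₂ τ = x
  /-- every cell covered by a listed `p`-cell is a listed `(p-1)`-cell -/
  exists_eq_of_covBy_left : ∀ σ x, x ⋖ ι₁ σ → ∃ ν, ι₀ ν = x
  /-- covers of `(p+1)`-cells over `p`-cells are exactly the nonzero incidences `[τ : σ]` -/
  covBy_iff_upInc : ∀ σ τ, ι₁ σ ⋖ ι₂ τ ↔ upInc b₁ d₂ e₂ σ τ ≠ 0
  /-- covers of `p`-cells over `(p-1)`-cells are exactly the nonzero incidences `[σ : ν]` -/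
  covBy_iff_downInc : ∀ ν σ, ι₀ ν ⋖ ι₁ σ ↔ downInc b₁ d₁ φ₀ ν σ ≠ 0

namespace IsDegreeSlice

variable {dim : K → ℕ} {b₁ : Basis K₁ F C₁} {d₁ : C₁ →ₗ[F] C₀} {d₂ : C₂ →ₗ[F] C₁}
  {e₂ : K₂ → C₂} {φ₀ : K₀ → C₀ →ₗ[F] F} {ι₀ : K₀ → K} {ι₁ : K₁ → K} {ι₂ : K₂ → K} {p : ℕ}
  (h : IsDegreeSlice dim b₁ d₁ d₂ e₂ φ₀ ι₀ ι₁ ι₂ p) {f : K → ℝ}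
include h

/-- A discrete Morse function on the cell poset satisfies Forman's condition (ii) at the
`(p+1)`-cells of the based triple (at most one exceptional facet). [cite: Forman1998, Def. 2.1 (ii)] -/
theorem isUpMorse (hf : IsDiscreteMorseFunction f) :
    IsUpMorse b₁ d₂ e₂ (f ∘ ι₁) (f ∘ ι₂) := by
  intro τ σ hσ σ' hσ'
  apply h.injective
  exact hf.subsingleton_facetsGE (ι₂ τ) ⟨(h.covBy_iff_upInc σ τ).2 hσ.1, hσ.2⟩
    ⟨(h.covBy_iff_upInc σ' τ).2 hσ'.1, hσ'.2⟩

/-- A discrete Morse function on the cell poset satisfies Forman's condition (i) at the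
`(p-1)`-cells of the based triple (at most one exceptional cofacet). [cite: Forman1998, Def. 2.1 (i)] -/
theorem isDownMorse (hf : IsDiscreteMorseFunction f) :
    IsDownMorse b₁ d₁ φ₀ (f ∘ ι₀) (f ∘ ι₁) := by
  intro ν σ hσ σ' hσ'
  apply h.injective
  exact hf.subsingleton_cofacetsLE (ι₀ ν) ⟨(h.covBy_iff_downInc ν σ).2 hσ.1, hσ.2⟩
    ⟨(h.covBy_iff_downInc ν σ').2 hσ'.1, hσ'.2⟩

/-- Criticality in the based triple (nonzero incidences) is criticality in the cell poset
(covers). [cite: Forman1998, Def. 2.2] -/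
theorem isCriticalCell_iff (σ : K₁) :
    IsCriticalCell b₁ d₁ d₂ e₂ φ₀ (f ∘ ι₀) (f ∘ ι₁) (f ∘ ι₂) σ ↔ IsCritical f (ι₁ σ) := by
  rw [isCritical_iff_forall_lt]
  constructor
  · rintro ⟨hup, hdown⟩
    refine ⟨fun x hx => ?_, fun x hx => ?_⟩
    · obtain ⟨τ, rfl⟩ := h.exists_eq_of_covBy_right σ x hx
      exact hup τ ((h.covBy_iff_upInc σ τ).1 hx)
    · obtain ⟨ν, rfl⟩ := h.exists_eq_of_covBy_left σ x hx
      exact hdown ν ((h.covBy_iff_downInc ν σ).1 hx)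
  · rintro ⟨hup, hdown⟩
    exact ⟨fun τ hτ => hup _ ((h.covBy_iff_upInc σ τ).2 hτ),
      fun ν hν => hdown _ ((h.covBy_iff_downInc ν σ).2 hν)⟩

/-- The critical cells of the based triple are in bijection with the critical `p`-cells of the
cell poset, so their number is the Morse number `m_p(f)`. [cite: Forman1998, Def. 2.2 and p. 107] -/
theorem nat_card_critical_eq_morseNumber :
    Nat.card {σ : K₁ // IsCriticalCell b₁ d₁ d₂ e₂ φ₀ (f ∘ ι₀) (f ∘ ι₁) (f ∘ ι₂) σ} =
      morseNumber dim f p := by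
  rw [morseNumber, ← Nat.card_coe_set_eq]
  refine Nat.card_congr
    { toFun := fun σ => ⟨ι₁ σ.1, (h.isCriticalCell_iff σ.1).1 σ.2, h.dim_eq σ.1⟩
      invFun := fun x => ⟨(h.exists_eq x.1 x.2.2).choose, (h.isCriticalCell_iff _).2 (by
          rw [(h.exists_eq x.1 x.2.2).choose_spec]; exact x.2.1)⟩
      left_inv := fun σ => Subtype.ext
        (h.injective (h.exists_eq (ι₁ σ.1) (h.dim_eq σ.1)).choose_spec)
      right_inv := fun x => Subtype.ext (h.exists_eq x.1 x.2.2).choose_spec }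

/-- **The weak Morse inequality `b_p ≤ m_p(f)`, cell-poset form.** For a real-valued discrete
Morse function `f` on a cell poset whose degree `p` is realised by three consecutive terms
`C₂ → C₁ → C₀` (`im d₂ ⊆ ker d₁`) of a based complex over a division ring, `dim (ker d₁ / im d₂)`
is at most the Morse number `m_p(f)` (Forman 1998, Cor. 8.3; Kozlov 2008, Thm. 11.24).
[cite: Kozlov2008, Thm. 11.24] -/
theorem finrank_homology_le_morseNumber [Fintype K₁]
    (hd : LinearMap.range d₂ ≤ LinearMap.ker d₁) (hf : IsDiscreteMorseFunction f) :
    finrank F (LinearMap.ker d₁ ⧸ (LinearMap.range d₂).comap (LinearMap.ker d₁).subtype) ≤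
      morseNumber dim f p := by
  rw [← h.nat_card_critical_eq_morseNumber]
  exact finrank_ker_quotient_range_le_card_critical hd (h.isUpMorse hf) (h.isDownMorse hf)

/-- **Cell count, cell-poset form**: `#(p-cells) ≤ m_p(f) + rank d₁ + rank d₂` (no hypothesis
`im d₂ ⊆ ker d₁` needed). [cite: Kozlov2008, Thm. 11.24] -/
theorem card_le_morseNumber_add [Fintype K₁] (hf : IsDiscreteMorseFunction f) :
    Fintype.card K₁ ≤ morseNumber dim f p + finrank F (LinearMap.range d₁) +
      finrank F (LinearMap.range d₂) := by
  rw [← h.nat_card_critical_eq_morseNumber]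
  exact card_le_card_critical_add_finrank_range_add (h.isUpMorse hf) (h.isDownMorse hf)

end IsDegreeSlice

end Bridge

end Literature.AlgebraicTopology.DiscreteMorseTheory
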